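import Summits.BirchSwinnertonDyer.BirchSwinnertonDyer.Theorems.PrintX9HowardContainmentOfKolyvaginSystemLeaf
import Summits.BirchSwinnertonDyer.BirchSwinnertonDyer.Theorems.PrintX10bMuPartOfPrintKSAnyClassNumber
import Summits.BirchSwinnertonDyer.BirchSwinnertonDyer.Theorems.PrintX10bControlGlueKSAnyClassNumber
import HarnessLib

/-!
# Row 9's A-side from THREE print leaves — Howard Thm. 1.6.1 (F-161), CGLS Thm. 4.1.1 in Kolyvagin-system form (F-411),
# CGS Thm. 6.5.2 (`hCGS`) — with NO class-number case split: Mastella–Zerman 2026 Cor. 4.6 (`hMZ`) leaves the trust base;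
# display `bsdpOnClassX9_of_sixLeaves`

Cell `pub/bsd-print-x9`, seat `bsd-line-x9-p1` (LEAD g7), `--supports` stmt-BirchSwinnertonDyer-25235 (helper). THEOREMS ONLY.

WHY. `PrintX9OfKolyvaginSystemLeaf.howardContainmentLightFramePinned_of_howard_kolyvaginSystem_mz_cgs` (p690035, this seat) splits
on `p ∣ h_K`: the `p ∣ h_K` branch runs the Kolyvagin-system μ-chain (F-161, F-411, the kernel letters of CG-FRAME) through the
route-free core `HeegnerStabilizedOfKSLeaf.exists_coherentPair_isTorsion_muIneq_of_howard_kolyvaginSystem` (p689159), the `p ∤ h_K`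
branch cites MZ26 Cor. 4.6 (`PrintX9Rung.stmt_coprimeTied hMZ`). FINDING «hhK-IDLE» (bsd-line-x10b-p1 LEAD g11, 2026-08-29T02:41:55Z,
tree read with line numbers): NO proof of the KS μ-chain ever uses the binders `p ∣ NumberField.classNumber K`, `¬ W.HasCM`,
`MastellaZerman2026.HasPadicScalarImage W p` — they are only threaded through the letters; the re-threaded chain K1–K3
(`Theorems/PrintX9MuPartKSLettersAnyClassNumber`, `…ControlGlueKSAnyClassNumber`, `…MuPartOfPrintKSAnyClassNumber`) proves the
core's strengthened μ-letter on EVERY μ-frame. The engine (`exists_coherent_pair_envelope_class`), the frame hypotheses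
(`X9.thm413Hypotheses_of_lightFrame`), CGS 6.5.2 and the promotion never had a class-number hypothesis. So the `p ∣ h_K` proof of
p690035 §4 runs verbatim on every rank-one light X9 frame, and `hMZ` is idle.

WHAT.
* **`howardContainmentLightFramePinned_of_howard_kolyvaginSystem_cgs :
  HowardDVRKolyvaginBound → CGLSHeegnerKolyvaginSystem → CGSHowardDivisibilityPLocalized → HowardContainmentLightFramePinned`**
  (item 26356 from THREE `closes`-binders; no `hMZ`, no `hNV`, no `hCG`; the sharp tower and Kummer = strict on the frames are
  kernel theorems).
* (The by-name form for the deciding crux decl 27077, `HowardDVRKolyvaginBound → CGLSHeegnerKolyvaginSystem →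
  HowardContainmentLightFramePinnedOfPrintSharp`, is ALREADY landed as `howardContainmentLightFramePinnedOfPrintSharp_of_howard_kolyvaginSystem`
  (p690035) — same type; with this file its `hMZ` is idle too: `fun h161 hKS _hMZ _hNV hCGS _hTw ↦ …_cgs h161 hKS hCGS`.)
* **`bsdpOnClassX9_of_sixLeaves (hH hK hCGS hPT hHP hCP hT hμ) : Rank1Residual.BSDpOnClassX9`** — the X9 leaf from SIX cite-only
  print leaves {F-161, F-411, CGS 6.5.2, `PinnedTransferPrintFacts`, `HeegnerPrintFactsX9`, `CyclotomicPrintFactsX9`} and the two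
  K6 μ-inputs (`MuTransfer`, `AnalyticMuZeroX9`); compare `bsdpOnClassX9_of_sevenLeaves` (p690035: + `hMZ`) and
  `PrintX9LeafOfPrintLeaves.bsdpOnClassX9_of_nineLeaves` (+ `hMZ`, `hNV`, `hCG`).
CONDITIONAL on the leaves named; no item is closed by this file as typed; no route verb is implied (the glue consolidation is the
pen's t3⁸). «beyond-print theorem»: no. No summit statement is proved; BSD is NOT proved by any of this.

References: [Howard2004HeegnerKolyvagin] Thm. 1.6.1, proof of Thm. 2.2.10, Thm. B; [CastellaGrossiLeeSkinner2022] Thm. 4.1.1, Rem. 4.1.4,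
Thm. 4.1.3; [CastellaGrossiSkinner2025] Thm. 6.5.2; [PerrinRiou1987BSMF] §3.4 Prop. 10.
-/

set_option linter.dupNamespace false
set_option autoImplicit false

noncomputable section

open scoped Classical Pointwise NumberField
open Field IsDedekindDomain
open Literature Literature.NumberTheory.EllipticCurves WeierstrassCurve
  Literature.NumberTheory.EllipticCurves.ModularForms
  Literature.NumberTheory.EllipticCurves.CastellaGrossiLeeSkinner2022
  Literature.NumberTheory.GaloisCohomology.Howard2004 Literature.NumberTheory.GaloisRepresentations
open Summit.BirchSwinnertonDyer.BirchSwinnertonDyer.Theses.PrintX9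
open Summit.BirchSwinnertonDyer.BirchSwinnertonDyer.Theorems

namespace Summit.BirchSwinnertonDyer.BirchSwinnertonDyer.Theorems.PrintX9OfKolyvaginSystemLeaf

/-- **`HowardContainmentLightFramePinned` (stmt-BirchSwinnertonDyer-26356) from THREE cite-only print leaves — F-161, F-411, CGS 6.5.2
— on EVERY rank-one light X9 frame, without a class-number case split.**  The `p ∣ h_K` branch of
`howardContainmentLightFramePinned_of_howard_kolyvaginSystem_mz_cgs` run on all frames through the any-class-number μ-letter
(K3 `HeegnerMuPartKSAnyClassNumber.exists_coherentPair_isTorsion_muIneq_of_howard_kolyvaginSystem_anyClassNumber_of_controlGlue`,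
bsd-line-x10b-p1 LEAD g11 p691788, fed with the any-class-number control glue `HeegnerMuPartControlGlue.controlGlueKS_anyClassNumber`,
x10b-p1-w8 g9 K2c): the engine's coherent pair WITH CLASS on `(Dt, H.β)`, `κ_∞ ≠ 0` from F-411, torsion and the
μ-inequality from `Λ`-rank one (`hCGS`), the forward envelope, the CGS 6.5.2 p-localized containment and the promotion.
CONDITIONAL on the three leaves. [cite: Howard2004HeegnerKolyvagin, Thm. 1.6.1, proof of Thm. 2.2.10, Thm. B]
[cite: CastellaGrossiLeeSkinner2022, Thm. 4.1.1, Rem. 4.1.4] [cite: CastellaGrossiSkinner2025, Thm. 6.5.2] -/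
theorem howardContainmentLightFramePinned_of_howard_kolyvaginSystem_cgs :
    HowardDVRKolyvaginBound → CGLSHeegnerKolyvaginSystem → CGSHowardDivisibilityPLocalized →
      HowardContainmentLightFramePinned := by
  intro h161 hKS hCGS W _ _ p _ _ K _ _ hX9 hK hodd h3 hHN hHp hirr κ hκ γ hγ Dt H ιC _hc _hrk _hfin
  letI : Algebra K ℂ := ιC.toAlgebra
  let jbar : AlgebraicClosure K →+* ℂ :=
    (IsAlgClosed.lift (R := K) (M := ℂ) (S := AlgebraicClosure K)).toRingHom
  obtain ⟨D⟩ := LambdaAdicSelmerDataExists.nonempty_lambdaAdicSelmerData (W.baseChange K) p κ hγ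
  obtain ⟨X⟩ := (W.baseChange K).nonempty_selmerDualData_holds κ γ hγ
  have hp : p.Prime := Fact.out
  have hX9' := Summit.BirchSwinnertonDyer.BirchSwinnertonDyer.Rank1Residual.classX9_census_of_classX9 W p hX9
  have hp_odd : Odd p := hp.odd_of_ne_two hX9'.ne_two
  have hyp := Summit.BirchSwinnertonDyer.Rank1Residual.X9.thm413Hypotheses_of_lightFrame hX9' hK hodd h3 hHN hHp hκ hγ
  -- the any-class-number μ-letter at `(Dt, H.β, D, X)`: the engine's coherent pair `(C, F)` with torsion and the
  -- μ-inequality granted rank one (F-161, F-411 BY NAME; CG-FRAME kernel letters inside; NO `p ∣ h_K`)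
  have h161' : thm161_dvrKolyvaginBound := h161
  have hKS' : thm411_exists_kolyvaginSystem_one_ne_zero := hKS
  obtain ⟨C, F, -, hFDt, -, -, hfwd, ⟨g, hg, hrev⟩, htor_of, hμ_of⟩ :=
    HeegnerMuPartKSAnyClassNumber.exists_coherentPair_isTorsion_muIneq_of_howard_kolyvaginSystem_anyClassNumber_of_controlGlue
      h161' hKS' HeegnerMuPartControlGlue.controlGlueKS_anyClassNumber
      (W.conductorNorm ℤ) W K p κ γ jbar hyp hX9'.irr hirr hHp hX9'.not_dvd_conductorNorm
      (fun k ↦ Literature.NumberTheory.EllipticCurves.anticyclotomicTowerSharp K p hp_odd hK κ hκ jbar k)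
      (card_ringClassGalOver_prime_one_of_frame hK hodd h3 hp hHp jbar) Dt H.β H.dvd_sq_sub D X
  -- CGS Thm. 6.5.2 BY NAME at `(D, C, X)`: finiteness and `Λ`-rank one
  have h652 : CastellaGrossiSkinner2025.thm652_stabilized_rankOne_charIdeal_torsion_dvd_pLocalized.{0} := hCGS
  obtain ⟨⟨hfinS, hS1⟩, hfinX, -, -⟩ := h652 (W.conductorNorm ℤ) W K p κ γ jbar hyp D C X
  haveI := hfinS
  haveI := hfinX
  haveI : IsNoetherian (IwasawaAlgebra p) X.X := isNoetherian_of_isNoetherianRing_of_finite _ _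
  haveI : Module.Finite (IwasawaAlgebra p) (Submodule.torsion (IwasawaAlgebra p) X.X) := inferInstance
  haveI : Module.Finite (IwasawaAlgebra p) (D.S ⧸ stabilizedHeegnerModule D C) := inferInstance
  -- torsion of `𝔖 ⧸ Λκ_∞(C)` (from `κ_∞ ≠ 0` and rank one) and the μ-inequality at `(p)`
  obtain ⟨-, htorC⟩ := htor_of hfinS hS1
  have hμ := hμ_of hfinS hfinX hS1
  have htorF : Module.IsTorsion (IwasawaAlgebra p) (D.S ⧸ heegnerModule D F) :=
    isTorsion_quotient_heegnerModule_of_smul_stabilizedHeegnerModule_le D F C hg hrev htorC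
  -- `I(ℋ_F) ⊆ I(Λκ_C)` (forward envelope)
  have henv : heegnerCharIdeal D F ≤ stabilizedHeegnerCharIdeal D C :=
    heegnerCharIdeal_le_stabilizedHeegnerCharIdeal_of_le D F C htorF hfwd
  -- `(p^m) · I(Λκ_C)² ⊆ char(𝒳_tors)` (CGS 6.5.2 p-localized)
  obtain ⟨m, hm⟩ := CastellaGrossiSkinner2025.span_pow_mul_sq_le_charIdeal_torsion_of_thm652_stabilized h652 hyp D C X
  have hC2 : stabilizedHeegnerCharIdeal D C ^ 2 ≤
      Module.charIdeal (IwasawaAlgebra p) (Submodule.torsion (IwasawaAlgebra p) X.X) := by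
    rw [stabilizedHeegnerCharIdeal_def] at hm ⊢
    exact IwasawaAlgebra.sq_charIdeal_le_charIdeal_of_span_p_pow_mul_le_of_lengthAt_le_two_mul
      (Submodule.torsion_isTorsion (R := IwasawaAlgebra p) (M := X.X)) htorC hμ hm
  exact ⟨jbar, D, F, X, hFDt, (Ideal.pow_right_mono henv 2).trans hC2⟩

/-- **DISPLAY — `BSD_p` on the X9 leaf from SIX cite-only print leaves and the two K6 μ-inputs**: Howard 2004 Thm. 1.6.1 (F-161),
CGLS 2022 Thm. 4.1.1 in Kolyvagin-system form (F-411), CGS 2025 Thm. 6.5.2, `PinnedTransferPrintFacts`, `HeegnerPrintFactsX9`,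
`CyclotomicPrintFactsX9`, and `MuTransfer` / `AnalyticMuZeroX9` (items 19629 / 19630).  The term of `PrintX9.closes` with the landed
assembly (`TorsionLayerPinned.assemblyLightFramePinned_holds`), the landed T-G′ door (`PrintX9Pinned.twoSidedLinkPinnedOfPrint_holds`)
and the three-leaf A-side above; versus `bsdpOnClassX9_of_sevenLeaves` Mastella–Zerman 2026 Cor. 4.6 is gone.  CONDITIONAL on the
eight hypotheses; a display, not a closure. [cite: Howard2004HeegnerKolyvagin, Thm. 1.6.1, Thm. B]
[cite: CastellaGrossiLeeSkinner2022, Thm. 4.1.1, Rem. 4.1.4] [cite: CastellaGrossiSkinner2025, Thm. 6.5.2] -/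
theorem bsdpOnClassX9_of_sixLeaves
    (hH : HowardDVRKolyvaginBound) (hK : CGLSHeegnerKolyvaginSystem) (hCGS : CGSHowardDivisibilityPLocalized)
    (hPT : PinnedTransferPrintFacts) (hHP : HeegnerPrintFactsX9) (hCP : CyclotomicPrintFactsX9)
    (hT : MuTransfer) (hμ : AnalyticMuZeroX9) :
    Summit.BirchSwinnertonDyer.BirchSwinnertonDyer.Rank1Residual.BSDpOnClassX9 :=
  Summit.BirchSwinnertonDyer.BirchSwinnertonDyer.Rank1Residual.TorsionLayerPinned.assemblyLightFramePinned_holds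
    (howardContainmentLightFramePinned_of_howard_kolyvaginSystem_cgs hH hK hCGS)
    (Summit.BirchSwinnertonDyer.BirchSwinnertonDyer.Theorems.PrintX9Pinned.twoSidedLinkPinnedOfPrint_holds hPT hHP)
    hT hμ hHP hCP

end Summit.BirchSwinnertonDyer.BirchSwinnertonDyer.Theorems.PrintX9OfKolyvaginSystemLeaf

end
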